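import Literature.ModelTheory.FiniteModelTheory.CFIMatchingCount
import Literature.ModelTheory.FiniteModelTheory.CkEquivTransfer
import Literature.ModelTheory.FiniteModelTheory.CountingWidthProofs
import HarnessLib

/-!
# Dawar–Wilsenach 2025, Theorem 7.2: CFI matching graphs with different numbers of perfect matchings

Everything PROVED; no named facts. Assembly of `CFIMatchingBase.lean` (3-regular expander bases),
`CFIMatchingGraphs.lean` (the graphs, Duplicator's strategy) and `CFIMatchingCount.lean` (the count):
for every `k` there are two balanced bipartite graphs on `m = O(k)` vertices, `≡^{C^k}`-equivalent
(the tree's `CkEquiv k`), with different numbers of perfect matchings — Theorem 7.2 in the family form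
`h72` consumed by `DawarWilsenach2025_thm71_of_thm51_thm64_thm72`.

## References

* A. Dawar, G. Wilsenach, *Symmetric arithmetic circuits*, Theory of Computing 21 (2025), Thm. 7.2 and
  its proof, §7.2, pp. 19–24.
-/

noncomputable section

open scoped Classical

namespace Literature.ModelTheory.FiniteModelTheory.CFIMatching

open Finset
open Literature.Computability.Complexity.Expander (RotGraph)
open TseitinColouring (EdgeExpansion Params)

/-- Bipartiteness is transported along a bijection of the vertices. [folklore] -/
theorem isBipartiteWith_map {V W : Type*} {G : SimpleGraph V} {s t : Set V} (h : G.IsBipartiteWith s t)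
    (e : V ≃ W) : (G.map e.toEmbedding).IsBipartiteWith (e '' s) (e '' t) := by
  refine ⟨(Set.disjoint_image_iff e.injective).2 h.disjoint, fun v w hvw => ?_⟩
  rw [SimpleGraph.map_adj] at hvw
  obtain ⟨v', w', hadj, rfl, rfl⟩ := hvw
  rcases h.mem_of_adj hadj with ⟨hv, hw⟩ | ⟨hv, hw⟩
  · exact Or.inl ⟨Set.mem_image_of_mem _ hv, Set.mem_image_of_mem _ hw⟩
  · exact Or.inr ⟨Set.mem_image_of_mem _ hv, Set.mem_image_of_mem _ hw⟩

/-- The two sides of a bipartition by a set and its complement cover everything after transport. [folklore] -/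
theorem image_union_image_compl {V W : Type*} (e : V ≃ W) (s : Set V) : e '' s ∪ e '' sᶜ = Set.univ := by
  rw [← Set.image_union, Set.union_compl_self, Set.image_univ_of_surjective e.surjective]

/-- **Theorem 7.2 over any family of constant-degree edge expanders** (`P : Params`: degree `d`,
expansion `η`, a rotation map `R m` on every `m`): for every `k`, the CFI matching graphs
`M(R₃, 0)` and `M(R₃, 1_x)` over the 3-regular base `R₃ = base3 (R (A k + 2))` are balanced
bipartite graphs on `17 · (A k + 2) · 2 (d+1)` vertices, `≡^{C^k}`-equivalent, with different
numbers of perfect matchings. [cite: DawarWilsenach2025, Thm 7.2 (proof, p. 24)] -/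
theorem thm72_of_params (P : Params) :
    ∃ c : ℕ, ∀ k : ℕ, ∃ m : ℕ, m ≤ c * k + c ∧ ∃ X Y : SimpleGraph (Fin m),
      (∃ s t : Set (Fin m), X.IsBipartiteWith s t ∧ s ∪ t = Set.univ) ∧
      (∃ s t : Set (Fin m), Y.IsBipartiteWith s t ∧ s ∪ t = Set.univ) ∧
      CkEquiv k X Y ∧
      Nat.card {M : X.Subgraph // M.IsPerfectMatching} ≠ Nat.card {M : Y.Subgraph // M.IsPerfectMatching} := by
  -- constants
  have hη3 : 0 < η₃ P.η P.d := η₃_pos P.η_pos P.d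
  set D : ℝ := η₃ P.η P.d * (2 * (P.d + 1)) with hD
  have hDpos : 0 < D := by rw [hD]; positivity
  set A : ℕ := ⌈6 / D⌉₊ + 1 with hA
  have hA6 : (6 : ℝ) ≤ D * A := by
    have h1 : 6 / D ≤ (⌈6 / D⌉₊ : ℝ) := Nat.le_ceil _
    have h2 : ((⌈6 / D⌉₊ : ℕ) : ℝ) ≤ A := by rw [hA]; exact_mod_cast Nat.le_succ _
    have := (div_le_iff₀ hDpos).1 (h1.trans h2)
    linarith
  refine ⟨17 * (2 * (P.d + 1)) * (A + 2), fun k => ?_⟩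
  -- the base
  set m₀ : ℕ := A * k + 2 with hm₀
  have hm₀2 : 2 ≤ m₀ := by rw [hm₀]; omega
  set M : ℕ := m₀ * 2 * (P.d + 1) with hMdef
  set R₃ : RotGraph M 3 := base3 (P.R m₀) with hR₃
  have hexp : EdgeExpansion R₃ (η₃ P.η P.d) := edgeExpansion_base3 _ (P.expands m₀)
  have hR : NoFixed R₃ := noFixed_base3 _
  have hT : TwoLeaving R₃ := twoLeaving_base3 _ (P.expands m₀) hm₀2
  have hM4 : 4 ≤ M := by
    rw [hMdef]
    calc 4 = 2 * 2 * 1 := by norm_num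
      _ ≤ m₀ * 2 * (P.d + 1) := by gcongr; omega
  have hM2 : 2 ≤ M := le_trans (by norm_num) hM4
  set x₀ : Fin M := ⟨0, by omega⟩ with hx₀
  -- the budget `6k < η₃ M`
  have hK : (2 * 3 * k : ℝ) < η₃ P.η P.d * M := by
    have hM : (M : ℝ) = (A * k + 2) * (2 * (P.d + 1)) := by rw [hMdef, hm₀]; push_cast; ring
    rw [hM]
    have hk : (0 : ℝ) ≤ k := Nat.cast_nonneg k
    have h1 : η₃ P.η P.d * ((A * k + 2) * (2 * (P.d + 1))) = D * A * k + D * 2 := by rw [hD]; ring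
    rw [h1]
    nlinarith
  -- the two graphs and their properties
  have hck : CkEquiv k (mgraph R₃ 0) (mgraph R₃ (Pi.single x₀ 1)) :=
    (ckEquiv_mgraph hexp (Pi.single x₀ 1) hM2 hK).symm
  have hne := card_perfectMatchings_ne x₀ hR hT
  -- transport to `Fin (17 M)`
  let e : MVert M ≃ Fin (17 * M) := Fintype.equivOfCardEq (by rw [card_MVert, Fintype.card_fin])
  refine ⟨17 * M, ?_, (mgraph R₃ 0).map e.toEmbedding, (mgraph R₃ (Pi.single x₀ 1)).map e.toEmbedding,
    ⟨_, _, isBipartiteWith_map (mgraph_isBipartiteWith R₃ 0) e, image_union_image_compl e _⟩,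
    ⟨_, _, isBipartiteWith_map (mgraph_isBipartiteWith R₃ _) e, image_union_image_compl e _⟩,
    hck.iso_congr (SimpleGraph.Iso.map e _) (SimpleGraph.Iso.map e _), ?_⟩
  · -- size `17 M ≤ c k + c`
    have h1 : m₀ ≤ (A + 2) * (k + 1) := by rw [hm₀]; nlinarith
    calc 17 * M = 17 * (2 * (P.d + 1)) * m₀ := by rw [hMdef]; ring
      _ ≤ 17 * (2 * (P.d + 1)) * ((A + 2) * (k + 1)) := Nat.mul_le_mul_left _ h1
      _ = 17 * (2 * (P.d + 1)) * (A + 2) * k + 17 * (2 * (P.d + 1)) * (A + 2) := by ring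
  · intro h
    exact hne ((Literature.Probability.LatticeModels.card_perfectMatchings_eq_of_iso (SimpleGraph.Iso.map e (mgraph R₃ 0))).trans
      (h.trans (Literature.Probability.LatticeModels.card_perfectMatchings_eq_of_iso
        (SimpleGraph.Iso.map e (mgraph R₃ (Pi.single x₀ 1)))).symm))

/-- **Dawar–Wilsenach 2025, Theorem 7.2, in the family form consumed by the proof of Theorem 7.1**
(`DawarWilsenach2025_thm71_of_thm51_thm64_thm72`, hypothesis `h72`): there is a constant `c` such
that for every `k` there are two bipartite graphs `X`, `Y` on a common vertex set `Fin m`,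
`m ≤ c·k + c`, which are `≡^{C^k}`-equivalent (the tree's `CkEquiv k`, Hella's bijective `k`-pebble
game) and have different numbers of perfect matchings. Printed: "There is, for each `k ∈ ℕ`, a
pair of balanced bipartite graphs `X` and `Y` with `O(k)` vertices, such that `X ≡^k Y`, and
`μ(X) − μ(Y) = 2^ℓ` for some `ℓ > 0`." Here: the CFI matching graphs `M(R₃, 0)`, `M(R₃, 1_x)` over
the 3-regular, 2-dart-connected edge expanders `base3 (X m)` built from the tree's zig-zag
expanders (in place of the printed "3-regular graph with treewidth at least `k` … by a standard
expander graph construction [1]"), `≡^{C^k}` by the local-consistency strategy (Lemma 7.4 via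
Atserias–Dawar rather than via treewidth and Dawar–Richerby), and `μ(X) − μ(Y) = ±2^M·|Ker ∂|`
(Lemmas 7.5–7.9; the exact power of two and its sign are not claimed).
[cite: DawarWilsenach2025, Thm 7.2 (pp. 19–24)] -/
theorem DawarWilsenach2025_thm72_family :
    ∃ c : ℕ, ∀ k : ℕ, ∃ m : ℕ, m ≤ c * k + c ∧ ∃ X Y : SimpleGraph (Fin m),
      (∃ s t : Set (Fin m), X.IsBipartiteWith s t ∧ s ∪ t = Set.univ) ∧
      (∃ s t : Set (Fin m), Y.IsBipartiteWith s t ∧ s ∪ t = Set.univ) ∧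
      CkEquiv k X Y ∧
      Nat.card {M : X.Subgraph // M.IsPerfectMatching} ≠ Nat.card {M : Y.Subgraph // M.IsPerfectMatching} :=
  thm72_of_params TseitinColouring.zigzagParams

end Literature.ModelTheory.FiniteModelTheory.CFIMatching
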